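import Literature.Claims.NS.Khedr2017
import Literature.Analysis.FluidPDE.WholeSpaceIBP
import Mathlib.Analysis.InnerProductSpace.Calculus

/-!
# C44 `Khedr2017` — refutation of the eigenvalue representation (Lemma l.188–192) and of the
# claimed structure theorem (Claim 1 = Theorem (Uniqueness) l.257–260)

D-0090 NS-CLAIMS, row C44: W. S. Khedr, «Nonconvection and uniqueness in Navier-Stokes
equation», arXiv:1706.02552 v1 (text of record; TeX `NewConcept1_v3.tex`, print pp.1–9).
Skeleton `Literature.Claims.NS.Khedr2017` (p479464, typist-12). Refuter ns-claims-refuter-5;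
the Step-2 kill is a port of typist-2 g2's kill-aid `kill-EigenRep.typist2-scratch.lean`.

* `not_EigenRepSelf`, `not_EigenRepAll` — **Step 2** (Lemma l.188, proof l.190–192, print p.6;
  re-used l.270–290, print p.8): «∇V V = λ_V V» fails for the rigid rotation
  `V x = (x₁, −x₀, 0)` at `x = e₀` (`DV·V = −e₀ ∦ V e₀ = −e₁`).
* `not_ClaimedTheorem` — **Claim 1 / Theorem (Uniqueness) / Corollary** (l.163–166, l.257–260,
  l.306; print pp.4, 7, 8): solid-body rotation `v = (x₁, −x₀, 0)`, `p = ½(x₀² + x₁²)`, `F = 0`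
  in the unit ball is a steady classical solution of (vmodel), square-integrable at every time,
  convective and not of the form `ψ(x,t)u(t)` (`isPossibleSolution_rot`, `not_isSeparatedOn_rot`).
* `claimedTheorem_fails_decaying` — the same inside the printed data classes (2)–(4) l.105–116:
  `v = e^{−t}(x₁, −x₀, 0)`, `p = ½e^{−2t}(x₀² + x₁²)`, force `F = −e^{−t}(x₁, −x₀, 0)` («F chosen
  arbitrarily», l.257) — smooth, decaying faster than any power, polynomial initial datum.
* `not_claimedTheorem_printClasses` — the referee's charitable retype R1 (`ClaimedTheorem_print`,
  data classes of §2 restored: bounded `Ω`, joint smoothness up to `t = 0` and `∂Ω`, decay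
  faster than every power), stated unfolded and refuted by the same decaying rotation
  (`rotDecay_rapid`: `‖e^{−t}Rx‖ ≤ K!/t^K`).
* helpers: `gradient_half_norm_sq`, `laplacian_clm`, `divergence_clm`, `convect_clm` (skew
  linear flows are steady Navier–Stokes flows with pressure `½‖Ax‖²`, any viscosity).

Classification: refuted-substantive at both grains (no side condition of the print is missed:
the countermodels are smooth, bounded-energy classical solutions on a bounded smooth domain;
the repaired statement «separated data launch separated solutions» is the conditional
Theorem 3.3, not Claim 1). Axioms: propext, Classical.choice, Quot.sound.

WHAT THIS IS NOT: not a claim about NS regularity or blow-up; not a claim about any author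
beyond the typed locator.
-/

noncomputable section

set_option linter.dupNamespace false

open Set Function MeasureTheory Metric
open scoped ContDiff RealInnerProductSpace Laplacian Topology
open Literature.Analysis.FluidPDE
open Literature.Claims.NS.Khedr2017

namespace Summit.NavierStokesRegularity.NavierStokesRegularity.Theorems.Khedr2017

/-- Rigid (solid-body) rotation about the `x₂`-axis as a continuous linear map:
`R x = (x₁, −x₀, 0)`. [folklore] -/
def rotL : E3 →L[ℝ] E3 :=
  (EuclideanSpace.proj (1 : Fin 3) : E3 →L[ℝ] ℝ).smulRight (EuclideanSpace.single 0 (1 : ℝ)) -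
    (EuclideanSpace.proj (0 : Fin 3) : E3 →L[ℝ] ℝ).smulRight (EuclideanSpace.single 1 (1 : ℝ))

/-- `R x = x₁ e₀ − x₀ e₁`. [folklore] -/
theorem rotL_apply (x : E3) :
    rotL x = (x 1) • EuclideanSpace.single 0 (1 : ℝ) - (x 0) • EuclideanSpace.single 1 (1 : ℝ) := by
  simp [rotL]

/-- Components of `R x`. [folklore] -/
theorem rotL_apply_zero (x : E3) : rotL x 0 = x 1 := by simp [rotL_apply]

/-- Components of `R x`. [folklore] -/
theorem rotL_apply_one (x : E3) : rotL x 1 = -x 0 := by simp [rotL_apply]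

/-- Components of `R x`. [folklore] -/
theorem rotL_apply_two (x : E3) : rotL x 2 = 0 := by simp [rotL_apply]

/-- `R` is skew-adjoint: `⟪R x, y⟫ = −⟪x, R y⟫`. [folklore] -/
theorem rotL_skew (x y : E3) : ⟪rotL x, y⟫ = -⟪x, rotL y⟫ := by
  simp only [PiLp.inner_apply, RCLike.inner_apply, conj_trivial, Fin.sum_univ_three,
    rotL_apply_zero, rotL_apply_one, rotL_apply_two]
  ring

/-! ### Step 2 (Lemma l.188–192): a vector field is not an eigenvector of its own gradient -/

/-- **Refutes `EigenRepSelf`** [refuted-substantive]: the printed «eigen value representation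
∇V V = λ_V V» (Lemma l.188, proof l.190–192, print p.6) fails for the rigid rotation
`V x = (x₁, −x₀, 0)`: `V` is linear, so `DV(x)[V x] = V(V x) = (−x₀, −x₁, 0)`, which at
`x = e₀` is `−e₀`, while `V e₀ = −e₁`; no scalar `λ` has `−e₀ = λ • (−e₁)`. No cheap repair:
`DV·V ∥ V` characterises fields whose streamlines carry no transverse acceleration, a closed
condition violated by every flow with curved streamlines. Port of typist-2 g2's kill-aid
(`kill-EigenRep.typist2-scratch.lean`). [cite: Khedr2017, Lemma l.188–192] -/
theorem not_EigenRepSelf : ¬ Literature.Claims.NS.Khedr2017.EigenRepSelf := by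
  intro H
  obtain ⟨lam, hlam⟩ := H (fun x => rotL x) rotL.contDiff
  have h := hlam (EuclideanSpace.single 0 (1 : ℝ))
  rw [rotL.fderiv] at h
  have h0 := congrArg (fun v : E3 => v 0) h
  simp [rotL_apply] at h0

/-- **Refutes `EigenRepAll`** (the form used at l.270–290, print p.8: one scalar `λ_W` for every
vector) — it contains `EigenRepSelf` (`eigenRepSelf_of_all`, skeleton). [refuted-substantive]
[cite: Khedr2017, proof of Theorem (Uniqueness) l.270–290] -/
theorem not_EigenRepAll : ¬ Literature.Claims.NS.Khedr2017.EigenRepAll := fun h =>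
  not_EigenRepSelf (eigenRepSelf_of_all h)

/-- Hence the printed route to Claim 1 (`claim_of_steps`) has a false premise: the composition
`Step_uniqProof → EigenRepAll → ClaimedTheorem` cannot be fed. (Recorded as the vacuity of the
second premise.) [cite: Khedr2017, Theorem (Uniqueness) l.257–300] -/
theorem claim_of_steps_premise_false : ¬ (Step_uniqProof ∧ EigenRepAll) := fun h =>
  not_EigenRepAll h.2

/-! ### The claimed theorem itself: solid-body rotation in a ball is a convective solution -/

/-- For a skew-adjoint linear field `A` the pressure `P = ½‖A x‖²` has `∇P(x) = −A(A x)`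
(the centripetal acceleration; Shvydkoy's rotational state, cf. the tree's
`IsHomogeneousSteadyEuler.rigidRotation`). [folklore] -/
theorem gradient_half_norm_sq (A : E3 →L[ℝ] E3) (hA : ∀ x y : E3, ⟪A x, y⟫ = -⟪x, A y⟫)
    (x : E3) : gradient (fun y => 2⁻¹ * ‖A y‖ ^ 2) x = -(A (A x)) := by
  have hsq : HasFDerivAt (fun y : E3 => 2⁻¹ * ‖A y‖ ^ 2)
      ((2⁻¹ : ℝ) • ((2 • innerSL ℝ (A x)).comp A)) x :=
    (((hasStrictFDerivAt_norm_sq (A x)).hasFDerivAt.comp x A.hasFDerivAt).const_mul 2⁻¹)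
  have hP : HasFDerivAt (fun y : E3 => 2⁻¹ * ‖A y‖ ^ 2)
      (InnerProductSpace.toDual ℝ E3 (-(A (A x)))) x := by
    refine hsq.congr_fderiv (ContinuousLinearMap.ext fun h => ?_)
    simp only [_root_.smul_apply, ContinuousLinearMap.comp_apply, innerSL_apply_apply,
      InnerProductSpace.toDual_apply_apply, inner_neg_left, smul_eq_mul, nsmul_eq_mul]
    rw [hA (A x) h]
    push_cast
    ring
  exact (hasGradientAt_iff_hasFDerivAt.mpr hP).gradient

/-- The Laplacian of a linear field vanishes. [folklore] -/
theorem laplacian_clm (A : E3 →L[ℝ] E3) (x : E3) : (Δ (fun y => A y)) x = 0 := by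
  rw [laplacian_eq_sum_fderiv_fderiv (stdOrthonormalBasis ℝ E3) A.contDiff x]
  refine Finset.sum_eq_zero fun i _ => ?_
  have h : (fun y => fderiv ℝ (fun y => A y) y (stdOrthonormalBasis ℝ E3 i)) =
      fun _ => A (stdOrthonormalBasis ℝ E3 i) := by
    funext y; rw [A.fderiv]
  rw [h]
  simp

/-- A skew-adjoint linear field is divergence free (`div A = tr A = 0`). [folklore] -/
theorem divergence_clm (A : E3 →L[ℝ] E3) (hA : ∀ x y : E3, ⟪A x, y⟫ = -⟪x, A y⟫) (x : E3) :
    VectorCalculus.divergence (fun y => A y) x = 0 := by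
  rw [divergence_eq_sum_inner_fderiv (stdOrthonormalBasis ℝ E3),
    show (fun y => A y) = (A : E3 → E3) from rfl, A.fderiv]
  refine Finset.sum_eq_zero fun i _ => ?_
  have h1 := hA (stdOrthonormalBasis ℝ E3 i) (stdOrthonormalBasis ℝ E3 i)
  rw [real_inner_comm] at h1
  linarith

/-- `(A·∇)A = A² x = −∇(½‖A x‖²)`: the steady momentum balance of a skew linear flow, with any
viscosity (the viscous term vanishes) and zero force. [folklore] -/
theorem convect_clm (A : E3 →L[ℝ] E3) (hA : ∀ x y : E3, ⟪A x, y⟫ = -⟪x, A y⟫) (μ : ℝ) (x : E3) :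
    convect (fun y => A y) (fun y => A y) x =
      μ • (Δ (fun y => A y)) x - gradient (fun y => 2⁻¹ * ‖A y‖ ^ 2) x + (0 : E3 → E3) x := by
  rw [convect_apply, show (fun y => A y) = (A : E3 → E3) from rfl, A.fderiv]
  rw [show (A : E3 → E3) = (fun y => A y) from rfl, laplacian_clm, gradient_half_norm_sq A hA]
  simp

/-- The scaled rotations `c • R` are skew-adjoint. [folklore] -/
theorem smul_rotL_skew (c : ℝ) (x y : E3) : ⟪(c • rotL) x, y⟫ = -⟪x, (c • rotL) y⟫ := by
  simp only [FunLike.coe_smul, Pi.smul_apply, inner_smul_left, inner_smul_right,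
    conj_trivial, rotL_skew x y, mul_neg]

/-- The pressure of solid-body rotation, `P x = ½ ‖R x‖² = ½ (x₀² + x₁²)`. [folklore] -/
def rotP (x : E3) : ℝ := 2⁻¹ * ‖rotL x‖ ^ 2

/-- **Solid-body rotation is a «possible solution»** of (vmodel) on `(0,∞) × B(0,1)` with
viscosity `μ`, force `0`, pressure `½(x₀² + x₁²)`: a steady classical Navier–Stokes solution
(`IsClassicalNSSolutionOnRegion.of_steady`), square-integrable on the ball at every time.
[folklore] -/
theorem isPossibleSolution_rot (μ : ℝ) :
    IsPossibleSolution μ (ball (0 : E3) 1) 0 (fun _ y => rotL y) (fun _ => rotP) := by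
  refine ⟨?_, fun t _ => ?_⟩
  · exact IsClassicalNSSolutionOnRegion.of_steady (ν := μ) (F := (0 : E3 → E3))
      rotL.contDiff.contDiffOn
      ((contDiff_const.mul (rotL.contDiff.norm_sq ℝ)).contDiffOn)
      (fun x _ => convect_clm rotL rotL_skew μ x) (fun x _ => divergence_clm rotL rotL_skew x)
      (Ioi (0 : ℝ))
  · have hc : Continuous fun y : E3 => ‖rotL y‖ ^ 2 := (rotL.continuous.norm).pow 2
    exact (hc.continuousOn.integrableOn_compact (isCompact_closedBall (0 : E3) 1)).mono_set
      ball_subset_closedBall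

/-- The points `½eᵢ` lie in the unit ball. [folklore] -/
theorem single_half_mem_ball (i : Fin 3) :
    (EuclideanSpace.single i (2⁻¹ : ℝ) : E3) ∈ ball (0 : E3) 1 := by
  rw [mem_ball_zero_iff, EuclideanSpace.single, PiLp.norm_single]
  norm_num

/-- **A scaled rotation `c(t) • R` with `c(1) ≠ 0` is not of the separated form `ψ(x,t) u(t)`**
on the ball: at `a = ½e₀` the velocity is `−(c/2)e₁`, at `b = ½e₁` it is `(c/2)e₀`, and no
single direction `u(1)` carries both. [folklore] -/
theorem not_isSeparatedOn_smul_rot (c : ℝ → ℝ) (hc : c 1 ≠ 0) :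
    ¬ IsSeparatedOn (ball (0 : E3) 1) (fun t y => c t • rotL y) := by
  rintro ⟨ψ, U, h⟩
  have h1 := h 1 one_pos _ (single_half_mem_ball 0)
  have h2 := h 1 one_pos _ (single_half_mem_ball 1)
  have e10 := congrArg (fun v : E3 => v 0) h1
  have e11 := congrArg (fun v : E3 => v 1) h1
  have e20 := congrArg (fun v : E3 => v 0) h2
  simp [rotL_apply] at e10 e11 e20
  rcases e10 with h0 | h0
  · rw [h0] at e11; simp [hc] at e11
  · rw [h0] at e20; simp [hc] at e20

/-- Solid-body rotation is not separated on the ball. [folklore] -/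
theorem not_isSeparatedOn_rot : ¬ IsSeparatedOn (ball (0 : E3) 1) (fun _ y => rotL y) := by
  have h := not_isSeparatedOn_smul_rot (fun _ => 1) one_ne_zero
  simpa only [one_smul] using h

/-- **Refutes `ClaimedTheorem`** (Claim 1 l.163–166 = Theorem (Uniqueness) l.257–260 =
Corollary l.306, print pp.4, 7, 8: «Let Ω, v₀ and F be chosen arbitrarily. Any possible
solution … is in the form v = ψ(x,t)u(t). In particular, it is non-convective»)
[refuted-substantive]: solid-body rotation `v = (x₁, −x₀, 0)`, `p = ½(x₀² + x₁²)`, `F = 0`,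
any `μ > 0`, on `Ω = B(0,1)` is a smooth, square-integrable, steady classical solution of
(vmodel) which is convective (`(v·∇)v = −(x₀, x₁, 0) ≠ 0`) and not separated. No cheap repair:
every classical flow with curved streamlines (Couette, Taylor–Green, Beltrami) is a
counterexample; restricting to separated data turns the statement into the conditional
existence Theorem 3.3; the printed decay of the data is met by `claimedTheorem_fails_decaying`.
[cite: Khedr2017, Theorem (Uniqueness) l.257–260; Claim 1 l.163–166] -/
theorem not_ClaimedTheorem : ¬ Literature.Claims.NS.Khedr2017.ClaimedTheorem := fun H =>
  not_isSeparatedOn_rot (H 1 one_pos (ball (0 : E3) 1) isOpen_ball 0 _ _ (isPossibleSolution_rot 1))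

/-! ### The same with the printed data classes (2)–(4): a decaying, forced rotation -/

/-- The decaying rotation is square-integrable on the ball at every time. [folklore] -/
theorem integrable_rotDecay (t : ℝ) :
    Integrable (fun x : E3 => ‖Real.exp (-t) • rotL x‖ ^ 2)
      (volume.restrict (ball (0 : E3) 1)) := by
  have hc : Continuous fun y : E3 => ‖Real.exp (-t) • rotL y‖ ^ 2 :=
    ((rotL.continuous.const_smul (Real.exp (-t))).norm).pow 2
  have hK : IntegrableOn (fun y : E3 => ‖Real.exp (-t) • rotL y‖ ^ 2) (closedBall (0 : E3) 1) :=
    hc.continuousOn.integrableOn_compact (isCompact_closedBall (0 : E3) 1)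
  exact hK.mono_set ball_subset_closedBall

/-- The momentum balance of the decaying forced rotation at `(t, x)`:
`−e^{−t}Rx + e^{−2t}R²x = μ·0 + e^{−2t}R²x − e^{−t}Rx`. [folklore] -/
theorem momentum_rotDecay (μ t : ℝ) (x : E3) :
    deriv (fun s : ℝ => Real.exp (-s) • rotL x) t
        + convect (fun y => Real.exp (-t) • rotL y) (fun y => Real.exp (-t) • rotL y) x =
      μ • (Δ (fun y => Real.exp (-t) • rotL y)) x
        - gradient (fun y => 2⁻¹ * ‖(Real.exp (-t) • rotL) y‖ ^ 2) x
        + -(Real.exp (-t) • rotL x) := by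
  have hd : HasDerivAt (fun s : ℝ => Real.exp (-s) • rotL x)
      ((Real.exp (-t) * -1) • rotL x) t :=
    ((Real.hasDerivAt_exp (-t)).comp t (hasDerivAt_neg t)).smul_const (rotL x)
  rw [hd.deriv]
  have hfun : (fun y => Real.exp (-t) • rotL y) = fun y => (Real.exp (-t) • rotL) y := rfl
  have key := convect_clm (Real.exp (-t) • rotL) (smul_rotL_skew _) μ x
  rw [hfun, key]
  simp only [Pi.zero_apply, add_zero, FunLike.coe_smul, Pi.smul_apply]
  rw [mul_neg_one, neg_smul]
  abel

/-- **Decaying solid-body rotation** `v(t,x) = e^{−t} R x`, `p(t,x) = ½ e^{−2t}(x₀² + x₁²)`,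
force `F(t,x) = −e^{−t} R x`, on `(0,∞) × B(0,1)`: a classical solution of (vmodel) for every
viscosity `μ` whose initial datum `R x` is `C²(Ω̄) ∩ V^{N+2}(Ω)` ((2) l.105), whose boundary
datum and force are `C^∞` and decay like `e^{−t}` — faster than the printed `t^{−K*}`, `t^{−K}`
of (3)–(4) l.109–116 — and which is square-integrable at every time (Definition l.154); «F
chosen arbitrarily» (Theorem (Uniqueness) l.257). [cite: Khedr2017, §2 (2)–(4) l.105–116] -/
theorem isPossibleSolution_rotDecay (μ : ℝ) :
    IsPossibleSolution μ (ball (0 : E3) 1) (fun t y => -(Real.exp (-t) • rotL y))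
      (fun t y => Real.exp (-t) • rotL y) (fun t y => 2⁻¹ * ‖(Real.exp (-t) • rotL) y‖ ^ 2) := by
  have hΩ : IsOpen (Ioi (0 : ℝ) ×ˢ ball (0 : E3) 1) := isOpen_Ioi.prod isOpen_ball
  refine ⟨(isClassicalNSSolutionOnRegion_iff_of_isOpen hΩ).2 ⟨?_, ?_, fun t x _ =>
    momentum_rotDecay μ t x, fun t x _ => ?_⟩, fun t _ => integrable_rotDecay t⟩
  · exact ((Real.contDiff_exp.comp contDiff_fst.neg).smul
      (rotL.contDiff.comp contDiff_snd)).contDiffOn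
  · refine (contDiff_const.mul (ContDiff.norm_sq ℝ ?_)).contDiffOn
    exact (Real.contDiff_exp.comp contDiff_fst.neg).smul (rotL.contDiff.comp contDiff_snd)
  · have hfun : (fun y => Real.exp (-t) • rotL y) = fun y => (Real.exp (-t) • rotL) y := rfl
    rw [hfun]
    exact divergence_clm _ (smul_rotL_skew _) x

/-- **The instance of `ClaimedTheorem` inside the printed data classes fails too**: the
decaying forced rotation of `isPossibleSolution_rotDecay` (μ = 1) is a possible solution and
is not separated (`e^{−1} ≠ 0`). [refuted-substantive]
[cite: Khedr2017, Theorem (Uniqueness) l.257–260; §2 (2)–(4) l.105–116] -/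
theorem claimedTheorem_fails_decaying :
    ¬ (IsPossibleSolution 1 (ball (0 : E3) 1) (fun t y => -(Real.exp (-t) • rotL y))
        (fun t y => Real.exp (-t) • rotL y) (fun t y => 2⁻¹ * ‖(Real.exp (-t) • rotL) y‖ ^ 2) →
      IsSeparatedOn (ball (0 : E3) 1) (fun t y => Real.exp (-t) • rotL y)) := fun h =>
  not_isSeparatedOn_smul_rot (fun t => Real.exp (-t)) (Real.exp_pos _).ne'
    (h (isPossibleSolution_rotDecay 1))

/-! ### The charitable retype (referee R1, `ClaimedTheorem_print`): data classes restored -/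

/-- `‖R x‖ ≤ ‖x‖` (`R` kills the `x₂`-component and rotates the rest). [folklore] -/
theorem norm_rotL_le (x : E3) : ‖rotL x‖ ≤ ‖x‖ := by
  have h2 : ‖rotL x‖ ^ 2 ≤ ‖x‖ ^ 2 := by
    rw [EuclideanSpace.norm_sq_eq, EuclideanSpace.norm_sq_eq]
    simp only [Fin.sum_univ_three, Real.norm_eq_abs, sq_abs, rotL_apply_zero, rotL_apply_one,
      rotL_apply_two]
    nlinarith [sq_nonneg (x 2)]
  exact (sq_le_sq₀ (norm_nonneg _) (norm_nonneg _)).mp h2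

/-- `e^{−t} ≤ K!/t^K` for `t > 0` (Mathlib `Real.pow_div_factorial_le_exp`): exponential decay
is faster than every power. [folklore] -/
theorem exp_neg_le_factorial_div (K : ℕ) {t : ℝ} (ht : 0 < t) :
    Real.exp (-t) ≤ (Nat.factorial K : ℝ) / t ^ K := by
  have h := Real.pow_div_factorial_le_exp t ht.le K
  rw [Real.exp_neg, inv_le_iff_one_le_mul₀ (Real.exp_pos t)]
  have hK : (0 : ℝ) < Nat.factorial K := by positivity
  have htK : 0 < t ^ K := by positivity
  rw [div_le_iff₀ hK] at h
  rw [div_mul_eq_mul_div, le_div_iff₀ htK]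
  linarith

/-- The decaying rotation (hence also the force, its negative) decays in time faster than
every power, uniformly on the unit ball: `‖e^{−t} R x‖ ≤ K!/t^K` for `t ≥ 1`, `‖x‖ < 1` — the
print's (bounddata)/(forcedata) «∼ t^{−K} for any K». [cite: Khedr2017, §2 (3)–(4) l.109–116] -/
theorem rotDecay_rapid (K : ℕ) (t : ℝ) (ht : 1 ≤ t) (x : E3) (hx : x ∈ ball (0 : E3) 1) :
    ‖Real.exp (-t) • rotL x‖ ≤ (Nat.factorial K : ℝ) / t ^ K := by
  rw [norm_smul, Real.norm_eq_abs, abs_of_pos (Real.exp_pos _)]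
  have hx1 : ‖rotL x‖ ≤ 1 := (norm_rotL_le x).trans (mem_ball_zero_iff.mp hx).le
  calc Real.exp (-t) * ‖rotL x‖ ≤ Real.exp (-t) * 1 :=
        mul_le_mul_of_nonneg_left hx1 (Real.exp_pos _).le
    _ ≤ (Nat.factorial K : ℝ) / t ^ K := by
        rw [mul_one]; exact exp_neg_le_factorial_div K (by linarith)

/-- **Refutes the charitable retype R1** (referee ns-claims-ref-4 g2, `ClaimedTheorem_print` of
`retype-Khedr2017.lean`, stated here verbatim-unfolded: Theorem 3.4 with the data classes of
§2 p.4 restored — `Ω` bounded open, force and solution jointly `C^∞` on `[0,∞) × Ω̄`, both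
decaying in time faster than every power on `Ω`, a possible solution in the typed sense)
[refuted-substantive]: the decaying forced rotation lies inside every class and is not
separated. [cite: Khedr2017, Theorem (Uniqueness) l.257–260; §2 (2)–(4) l.105–116] -/
theorem not_claimedTheorem_printClasses :
    ¬ (∀ μ : ℝ, 0 < μ → ∀ D : Set E3, IsOpen D → Bornology.IsBounded D →
      ∀ (F v : ℝ → E3 → E3) (p : ℝ → E3 → ℝ),
        ContDiffOn ℝ ∞ (uncurry F) (Ici 0 ×ˢ closure D) →
        (∀ K : ℕ, ∃ C : ℝ, ∀ t : ℝ, 1 ≤ t → ∀ x ∈ D, ‖F t x‖ ≤ C / t ^ K) →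
        ContDiffOn ℝ ∞ (uncurry v) (Ici 0 ×ˢ closure D) →
        (∀ K : ℕ, ∃ C : ℝ, ∀ t : ℝ, 1 ≤ t → ∀ x ∈ D, ‖v t x‖ ≤ C / t ^ K) →
        IsPossibleSolution μ D F v p → IsSeparatedOn D v) := by
  intro H
  have hsm : ContDiff ℝ ∞ (fun q : ℝ × E3 => Real.exp (-q.1) • rotL q.2) :=
    (Real.contDiff_exp.comp contDiff_fst.neg).smul (rotL.contDiff.comp contDiff_snd)
  have hv : ContDiffOn ℝ ∞ (uncurry fun (t : ℝ) (y : E3) => Real.exp (-t) • rotL y)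
      (Ici 0 ×ˢ closure (ball (0 : E3) 1)) := hsm.contDiffOn
  have hF : ContDiffOn ℝ ∞ (uncurry fun (t : ℝ) (y : E3) => -(Real.exp (-t) • rotL y))
      (Ici 0 ×ˢ closure (ball (0 : E3) 1)) := hsm.neg.contDiffOn
  have hFd : ∀ K : ℕ, ∃ C : ℝ, ∀ t : ℝ, 1 ≤ t → ∀ x ∈ ball (0 : E3) 1,
      ‖-(Real.exp (-t) • rotL x)‖ ≤ C / t ^ K := fun K =>
    ⟨Nat.factorial K, fun t ht x hx => by rw [norm_neg]; exact rotDecay_rapid K t ht x hx⟩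
  have hvd : ∀ K : ℕ, ∃ C : ℝ, ∀ t : ℝ, 1 ≤ t → ∀ x ∈ ball (0 : E3) 1,
      ‖Real.exp (-t) • rotL x‖ ≤ C / t ^ K := fun K =>
    ⟨Nat.factorial K, fun t ht x hx => rotDecay_rapid K t ht x hx⟩
  exact not_isSeparatedOn_smul_rot (fun t => Real.exp (-t)) (Real.exp_pos _).ne'
    (H 1 one_pos (ball (0 : E3) 1) isOpen_ball isBounded_ball
      (fun t y => -(Real.exp (-t) • rotL y)) (fun t y => Real.exp (-t) • rotL y)
      (fun t y => 2⁻¹ * ‖(Real.exp (-t) • rotL) y‖ ^ 2) hF hFd hv hvd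
      (isPossibleSolution_rotDecay 1))

end Summit.NavierStokesRegularity.NavierStokesRegularity.Theorems.Khedr2017

end
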